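import Summits.MatrixMultiplication.OmegaCensus.SmallFormats.RankOnePlaneCapQuant
import HarnessLib

/-!
# ω-census family (a): the SATURATED rank-one plane law — equality case of `(m−1)·|R| ≤ m·(r − (m+1)n)`

Cell `pub-omega` (unit `pub-omega-lit`, gen 6), topic `Summits/MatrixMultiplication/OmegaCensus`
(sub-folder `SmallFormats`). Framing (verbatim): lottery ticket; floor = certified bounds/negative
ranges. HONEST FRAMING: our elementary structural lemma (the equality case of gen-5's
`card_vanishing_quant`), a CONSTRAINT for the structured searches of the census (asked for by
pub-omega-tensor gen 5, 2026-08-21T03:32Z: six X-marginals of a hypothetical 23-term `𝔽₃`-scheme for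
`⟨2,2,7⟩` survive all caps and have 6–8 rank-one planes AT the cap `2r − 6n`); not a bound on any rank,
not progress on `ω`.

**Theorem** (`card_vanishing_quant_eq`). `k` a field, `c ≥ 2`, `m ≥ 1`, `β` a bilinear computation of
`⟨c,m,n⟩` (`X ∈ k^{c×m}`, `Y ∈ k^{m×n}`, outputs `W_i ∈ k^{c×n}`) of length `r`, `λ ∈ k^c ∖ 0`, `R` a set
of indices whose X-forms vanish on the plane `S^λ = {λ zᵀ : z ∈ k^m}`, and suppose the quantitative cap
is ATTAINED: `m·mn + mn + m|R| = m r + |R|` (for `m = 2`: `|R| = 2r − 6n`). Then there is `θ ∈ k^c`,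
`θ ≠ 0`, `θ ⊥ λ`, such that with `E := span{θᵀ W_i : i ∉ R} ⊂ kⁿ`:
* `dim E + mn = r − |R|` (for `⟨2,2,n⟩`: `dim E = 4n − r`);
* the common zeros of the Y-forms `g_i`, `i ∈ R`, are EXACTLY the matrices `Y` all of whose rows lie in
  `E` — equivalently every `g_i` (`i ∈ R`) kills `k^m ⊗ E`, i.e. its coefficient matrix has all rows in
  `F := E^⊥` (`dim F = n − dim E`; for `⟨2,2,n⟩`: `r − 3n`), and conversely nothing outside `k^m ⊗ E`
  is a common zero;
* the Y-forms `g_i`, `i ∈ R`, are linearly independent (so, by the dimension count, they span the whole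
  annihilator `(k^m)^* ⊗ F^*` of `k^m ⊗ E`).

*Proof.* Gen 5 proved `mn − |R| ≤ dim Z(R) ≤ m·dim E ≤ m(|Rᶜ| − mn)` with `Z(R)` the common zeros
(`finrank_span_rows_add_le`, `mn_le_card_add`); at equality every step is tight: the evaluation map
`G : Y ↦ (g_i(Y))_{i∈R}` has full rank `|R|` (independence), its kernel `Z(R)` injects into `E^m` with
equal dimension (so `Z(R) = {Y : rows in E}`), and `m·dim E = m(|Rᶜ| − mn)`. ∎

Sanity (outside Lean): Strassen's `⟨2,2,2⟩` (`r = 7`, plane "X-forms reading only row 2", `|R| = 2`):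
`G(M₂) = e₁e₁ᵀ`, `G(M₄) = (e₂ − e₁)e₁ᵀ` have rows in `F = ⟨e₁⟩`, are independent, and the second rows of
the other five outputs span `E = ⟨e₂⟩ = F^⊥`; the Hopcroft–Kerr schemes saturate for `n ≤ 5`.
-/

namespace Summit.MatrixMultiplication.OmegaCensus.RankOnePlaneCapGeneral

open Module Matrix Literature.Computability.AlgebraicComplexity

variable {k : Type*} [Field k] {c m n : ℕ} {ι : Type*} [Fintype ι]

/-- Step (2) made explicit: if the `θ`-rows of all outputs outside `R` lie in `E` (`θ` with a nonzero
coordinate), every common zero of the Y-forms of `R` has all its rows in `E`. -/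
theorem commonZero_row_mem (β : BilinComp (mulBilin k c m n) ι) {θ : Fin c → k} {κ' : Fin c}
    (hκ' : θ κ' ≠ 0) (R : Finset ι) (E : Submodule k (Fin n → k))
    (hE : ∀ i, i ∉ R → θ ᵥ* β.w i ∈ E) (Y : Matrix (Fin m) (Fin n) k)
    (hY : ∀ i ∈ R, β.g i Y = 0) (μ : Fin m) : Y μ ∈ E := by
  classical
  have h := β.map_eq_sum (Matrix.single κ' μ (1 : k)) Y
  rw [mulBilin_apply] at h
  have h1 : θ ᵥ* (Matrix.single κ' μ (1 : k) * Y) = θ κ' • Y μ := by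
    ext ν
    simp [Matrix.vecMul, dotProduct, single_mul_apply']
  have hmem : θ ᵥ* (Matrix.single κ' μ (1 : k) * Y) ∈ E := by
    rw [h, vecMul_sum_smul]
    refine Submodule.sum_mem _ fun i _ => ?_
    by_cases hiR : i ∈ R
    · rw [hY i hiR, mul_zero, zero_smul]
      exact Submodule.zero_mem _
    · exact Submodule.smul_mem _ _ (hE i hiR)
  have h2 : Y μ = (θ κ')⁻¹ • (θ κ' • Y μ) := by rw [smul_smul, inv_mul_cancel₀ hκ', one_smul]
  rw [h2, ← h1]
  exact Submodule.smul_mem _ _ hmem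

/-- **The saturated rank-one plane law** (equality case of `card_vanishing_quant`). -/
theorem card_vanishing_quant_eq [DecidableEq ι] (hc : 2 ≤ c) (hm : 1 ≤ m)
    (β : BilinComp (mulBilin k c m n) ι)
    {lam : Fin c → k} (hlam : lam ≠ 0) (R : Finset ι)
    (hR : ∀ i ∈ R, ∀ z : Fin m → k, β.f i (vecMulVec lam z) = 0)
    (heq : m * (m * n) + m * n + m * R.card = m * Fintype.card ι + R.card) :
    ∃ (θ : Fin c → k) (E : Submodule k (Fin n → k)),
      θ ≠ 0 ∧ θ ⬝ᵥ lam = 0 ∧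
      E = Submodule.span k ((fun i => θ ᵥ* β.w i) '' ↑(Finset.univ \ R)) ∧
      finrank k E + m * n = (Finset.univ \ R).card ∧
      (∀ Y : Matrix (Fin m) (Fin n) k, (∀ i ∈ R, β.g i Y = 0) ↔ ∀ μ, Y μ ∈ E) ∧
      LinearIndependent k (fun i : {i // i ∈ R} => β.g i.1) := by
  classical
  set Rc : Finset ι := Finset.univ \ R with hRc
  have hcardR : Rc.card + R.card = Fintype.card ι := by
    rw [hRc, Finset.card_sdiff_add_card_eq_card (Finset.subset_univ R), Finset.card_univ]
  have A1 : ∀ (z : Fin m → k) (Y : Matrix (Fin m) (Fin n) k), vecMulVec lam z * Y =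
      ∑ i ∈ Rc, (β.f i (vecMulVec lam z) * β.g i Y) • β.w i := by
    intro z Y
    have h := β.map_eq_sum (vecMulVec lam z) Y
    rw [mulBilin_apply] at h
    rw [h, ← Finset.sum_sdiff (Finset.subset_univ R), add_eq_left]
    exact Finset.sum_eq_zero fun i hi => by rw [hR i hi, zero_mul, zero_smul]
  -- `θ ⊥ λ` with a nonzero coordinate (as in `card_vanishing_quant`)
  obtain ⟨κ₁, hκ₁⟩ : ∃ κ, lam κ ≠ 0 := by
    by_contra h0
    simp only [not_exists, not_not] at h0
    exact hlam (funext h0)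
  obtain ⟨κ₂, hκ₂⟩ : ∃ κ : Fin c, κ ≠ κ₁ := by
    by_cases h0 : κ₁ = ⟨0, by omega⟩
    · exact ⟨⟨1, by omega⟩, fun h => by rw [h0] at h; exact absurd (congrArg Fin.val h) (by simp)⟩
    · exact ⟨⟨0, by omega⟩, fun h => h0 h.symm⟩
  set θ : Fin c → k := Pi.single κ₂ (lam κ₁) - Pi.single κ₁ (lam κ₂) with hθ
  have hθdot : θ ⬝ᵥ lam = 0 := by
    rw [hθ, sub_dotProduct, single_dotProduct, single_dotProduct]
    ring
  have hθlam : ∀ z : Fin m → k, θ ᵥ* vecMulVec lam z = 0 := by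
    intro z
    ext μ
    have : (θ ᵥ* vecMulVec lam z) μ = (θ ⬝ᵥ lam) * z μ := by
      simp [Matrix.vecMul, dotProduct, vecMulVec_apply, Finset.sum_mul, mul_assoc]
    rw [this, hθdot, zero_mul, Pi.zero_apply]
  have hκ' : θ κ₂ ≠ 0 := by
    rw [hθ, Pi.sub_apply, Pi.single_eq_same, Pi.single_eq_of_ne hκ₂, sub_zero]
    exact hκ₁
  have hθne : θ ≠ 0 := fun h0 => hκ' (by rw [h0]; rfl)
  -- step (1)
  set E : Submodule k (Fin n → k) := Submodule.span k ((fun i => θ ᵥ* β.w i) '' ↑Rc) with hEdef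
  have L1 : finrank k E + m * n ≤ Rc.card :=
    finrank_span_rows_add_le β.g hlam (fun i z => β.f i (vecMulVec lam z)) θ hθlam Rc.card Rc β.w
      rfl A1
  have hE : ∀ i, i ∉ R → θ ᵥ* β.w i ∈ E := by
    intro i hiR
    have hiRc : i ∈ Rc := Finset.mem_sdiff.2 ⟨Finset.mem_univ i, hiR⟩
    exact Submodule.subset_span ⟨i, by exact_mod_cast hiRc, rfl⟩
  -- step (2), structural version
  let G : Matrix (Fin m) (Fin n) k →ₗ[k] ({i // i ∈ R} → k) :=
    LinearMap.pi fun i : {i // i ∈ R} => β.g i.1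
  have hGapply : ∀ (Y : Matrix (Fin m) (Fin n) k) (i : {i // i ∈ R}), G Y i = β.g i.1 Y :=
    fun Y i => rfl
  have hkerR : ∀ Y, Y ∈ LinearMap.ker G ↔ ∀ i ∈ R, β.g i Y = 0 := by
    intro Y
    rw [LinearMap.mem_ker]
    constructor
    · intro hY i hi
      have := congrFun hY ⟨i, hi⟩
      simpa [hGapply] using this
    · intro hY
      funext i
      simpa [hGapply] using hY i.1 i.2
  have hrow : ∀ Y ∈ LinearMap.ker G, ∀ μ : Fin m, (Y μ : Fin n → k) ∈ E := fun Y hY μ =>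
    commonZero_row_mem β hκ' R E hE Y ((hkerR Y).1 hY) μ
  let ψ : LinearMap.ker G →ₗ[k] (Fin m → E) :=
    { toFun := fun Y μ => ⟨(Y : Matrix (Fin m) (Fin n) k) μ, hrow Y Y.2 μ⟩
      map_add' := fun Y Y' => by ext μ ν; rfl
      map_smul' := fun a Y => by ext μ ν; rfl }
  have hψ : Function.Injective ψ := by
    intro Y Y' hYY
    apply Subtype.ext
    ext μ ν
    have := congrArg (fun F => ((F μ : E) : Fin n → k) ν) hYY
    simpa [ψ] using this
  have hpi : finrank k (Fin m → E) = m * finrank k E := by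
    rw [Module.finrank_pi_fintype]
    simp [Finset.sum_const]
  have hker : finrank k (LinearMap.ker G) ≤ m * finrank k E := by
    have := LinearMap.finrank_le_finrank_of_injective hψ
    rwa [hpi] at this
  have hfun : finrank k ({i // i ∈ R} → k) = R.card := by
    rw [Module.finrank_fintype_fun_eq_card, Fintype.card_coe]
  have hrange : finrank k (LinearMap.range G) ≤ R.card := by
    have := Submodule.finrank_le (LinearMap.range G)
    rwa [hfun] at this
  have hrn := LinearMap.finrank_range_add_finrank_ker G
  have htop : finrank k (Matrix (Fin m) (Fin n) k) = m * n := by simp [Module.finrank_matrix]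
  -- the three equalities
  have L1' : m * finrank k E + m * (m * n) ≤ m * Rc.card := by
    have := Nat.mul_le_mul_left m L1
    rwa [Nat.mul_add] at this
  have hmul : m * Rc.card + m * R.card = m * Fintype.card ι := by rw [← Nat.mul_add, hcardR]
  have hrange_eq : finrank k (LinearMap.range G) = R.card := by omega
  have hker_eq : finrank k (LinearMap.ker G) = m * finrank k E := by omega
  have hmE : m * Rc.card = m * (finrank k E + m * n) := by rw [Nat.mul_add]; omega
  have hE_eq : finrank k E + m * n = Rc.card := (Nat.eq_of_mul_eq_mul_left hm hmE).symm
  -- `ψ` is onto, hence every matrix with rows in `E` is a common zero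
  have hψsurj : Function.Surjective ψ :=
    (LinearMap.injective_iff_surjective_of_finrank_eq_finrank (by rw [hker_eq, hpi])).1 hψ
  have hzero : ∀ Y : Matrix (Fin m) (Fin n) k, (∀ i ∈ R, β.g i Y = 0) ↔ ∀ μ, Y μ ∈ E := by
    intro Y
    constructor
    · intro hY μ
      exact hrow Y ((hkerR Y).2 hY) μ
    · intro hYE
      obtain ⟨Y', hY'⟩ := hψsurj fun μ => ⟨Y μ, hYE μ⟩
      have hYY' : (Y' : Matrix (Fin m) (Fin n) k) = Y := by
        ext μ ν
        have := congrArg (fun F => ((F μ : E) : Fin n → k) ν) hY'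
        simpa [ψ] using this
      have hmemker : Y ∈ LinearMap.ker G := by rw [← hYY']; exact Y'.2
      exact (hkerR Y).1 hmemker
  -- `G` is onto, hence the Y-forms of `R` are linearly independent
  have hGtop : LinearMap.range G = ⊤ :=
    Submodule.eq_top_of_finrank_eq (by rw [hrange_eq, hfun])
  have hGsurj : Function.Surjective G := LinearMap.range_eq_top.1 hGtop
  have hli : LinearIndependent k (fun i : {i // i ∈ R} => β.g i.1) := by
    rw [linearIndependent_iff']
    intro s e hs j hj
    obtain ⟨Y, hY⟩ := hGsurj (Pi.single j 1)
    have h1 := congrArg (fun φ : Module.Dual k (Matrix (Fin m) (Fin n) k) => φ Y) hs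
    simp only [LinearMap.coe_sum, Finset.sum_apply, LinearMap.smul_apply, LinearMap.zero_apply,
      smul_eq_mul] at h1
    have h2 : ∀ i ∈ s, e i * β.g i.1 Y = e i * (Pi.single j (1 : k) : {i // i ∈ R} → k) i := by
      intro i _
      rw [← hGapply Y i, hY]
    rw [Finset.sum_congr rfl h2, Finset.sum_eq_single j (fun i _ hij => by
      rw [Pi.single_eq_of_ne hij, mul_zero]) (fun hjs => absurd hj hjs)] at h1
    simpa using h1
  exact ⟨θ, E, hθne, hθdot, hEdef, hE_eq, hzero, hli⟩

/-- **`⟨2,2,n⟩` form** of the saturated plane law: if exactly `|R| = 2r − 6n` X-forms vanish on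
`{λ zᵀ}` (`c ≥ 2` rows of `X`, inner dimension `2`), then with `E = span{θᵀW_i : i ∉ R}` (`θ ⊥ λ`):
`dim E = |Rᶜ| − 2n` (`= 4n − r`), the common zeros of the Y-forms of `R` are exactly the `Y ∈ k^{2×n}`
with both rows in `E`, and those Y-forms are linearly independent. -/
theorem card_vanishing_eq_two_mul_sub [DecidableEq ι] (hc : 2 ≤ c)
    (β : BilinComp (mulBilin k c 2 n) ι)
    {lam : Fin c → k} (hlam : lam ≠ 0) (R : Finset ι)
    (hR : ∀ i ∈ R, ∀ z : Fin 2 → k, β.f i (vecMulVec lam z) = 0)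
    (heq : R.card + 6 * n = 2 * Fintype.card ι) :
    ∃ (θ : Fin c → k) (E : Submodule k (Fin n → k)),
      θ ≠ 0 ∧ θ ⬝ᵥ lam = 0 ∧
      E = Submodule.span k ((fun i => θ ᵥ* β.w i) '' ↑(Finset.univ \ R)) ∧
      finrank k E + 2 * n = (Finset.univ \ R).card ∧
      (∀ Y : Matrix (Fin 2) (Fin n) k, (∀ i ∈ R, β.g i Y = 0) ↔ ∀ μ, Y μ ∈ E) ∧
      LinearIndependent k (fun i : {i // i ∈ R} => β.g i.1) :=
  card_vanishing_quant_eq hc (by norm_num) β hlam R hR (by omega)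

end Summit.MatrixMultiplication.OmegaCensus.RankOnePlaneCapGeneral
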